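import Summits.QuantumFields.YangMills.Theorems.Instrument.ClosedComplexCountDFSBound
import Literature.Probability.LatticeModels.LatticeGraph
import HarnessLib

/-!
# Instrument cell `ym-instrument`, crew (b): TYPED lattice-animal constants for SITE animals of `ℤ⁴` — `#{X ∋ 0 connected, |X| = n+1} ≤ C(2n, n)·8ⁿ ≤ 32ⁿ`
# (DFS-contour count BY NAME) and `≤ 81ⁿ` (the tree's lazy-walk count BY NAME) — for the `threshold` row P-B5 (A-0826-28)

QUESTIONS.md: Q-B1 amendments A-0826-20 / A-0826-28 (P-B5 «p⋆ for the t100 ball constants», kind `threshold`: «animal bound by name, p_ent»; sc-plan 20:41:38Z: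
«the tree has NO lattice-animal decl — λ enters conditional_on as a cited Literature bound (λ = 2d·e = 8e, p_ent = log(8e) = 3.079) until typed»; the printed source of
`(eΔ)^{n−1}` is Bollobás–Riordan, *Percolation* (CUP 2006) Ch. 3 §3.5, proof of Lemma 11 / Bollobás Problem 45 — lit g0 LIT-INDEX Amendment 11; Kesten's own printed
bound is `7^{dn}`, Grimmett 1999 (4.24)); cell
`run/shared/lean/pub/ym-instrument/`, HUMAN RULING D-0084 (2), director-ym R138.  HONEST FRAMING (page 1, binding).  WHAT IS CERTIFIED HERE AND AT WHICH `(G, D, L, β)`: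
PURE COMBINATORICS of `ℤ⁴` (no group, no coupling, no measure): for the nearest-neighbour graph `zdGraph 4` (every site has `2d = 8` neighbours,
`LatticeGraph.card_neighborFinset_zdGraph_holds`), any finite family of `(n+1)`-point sets containing the origin and connected inside themselves from it has at most
★ `C(2n, n)·8ⁿ ≤ 32ⁿ` members (`ClosedComplexCountDFSBound.card_connectedFamily_le_choose`, the DFS-contour count) and at most `81ⁿ` members (the tree's
`LatticeAnimals.card_connectedFamily_le`, lazy walks).  I.e. a TYPED animal growth constant `λ_T = 32` (`p_ent,T = log 32 = 3.466`) today, against the CITED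
Bollobás–Riordan `λ = eΔ = 8e = 21.75` (`p_ent = 3.079`), which remains the sharper, conditional_on-cited value.  WHAT THIS IS NOT: not a statement about any gauge theory;
the threshold row it serves (card `cruxidea-stmt-QuantumFields-19354-4`, P-B5) is NON-RIGOROUS GUIDANCE ∕ table-derivable by the cell's own label, and nothing here
is summit-bearing.  Grade (T).
-/

noncomputable section

open Finset
open Literature.Probability.LatticeModels (Site zdGraph card_neighborFinset_zdGraph_holds card_connectedFamily_le)
open Summit.QuantumFields.YangMills.Theorems.Instrument.ClosedComplexCountDFSBound (card_connectedFamily_le_choose)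

namespace Summit.QuantumFields.YangMills.Theorems.Instrument.SiteAnimalBoundZ4

/-- Every site of `ℤ⁴` has at most `8` nearest neighbours (exactly `8`: `card_neighborFinset_zdGraph_holds`). [folklore] -/
theorem card_neighborFinset_le_eight (x : Site 4) : ((zdGraph 4).neighborFinset x).card ≤ 8 :=
  (card_neighborFinset_zdGraph_holds (d := 4) x).le.trans (by norm_num)

/-- ★ **Site animals of `ℤ⁴`, contour count**: a finite family of `(n+1)`-point subsets of `ℤ⁴`, each containing `v` and nearest-neighbour connected inside
itself from `v`, has at most `C(2n, n)·8ⁿ` members. [cite: FriedliVelenik2017, Lemma 3.38 and eq. (5.27)] -/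
theorem card_siteAnimals_le_choose (v : Site 4) (n : ℕ) (𝒮 : Finset (Finset (Site 4)))
    (h𝒮 : ∀ S ∈ 𝒮, v ∈ S ∧ S.card = n + 1 ∧
      ∀ w ∈ S, Relation.ReflTransGen (fun x y => (zdGraph 4).Adj x y ∧ x ∈ S ∧ y ∈ S) v w) :
    𝒮.card ≤ (2 * n).choose n * 8 ^ n :=
  card_connectedFamily_le_choose (fun x => (zdGraph 4).neighborFinset x) (R := (zdGraph 4).Adj) card_neighborFinset_le_eight
    (fun _ _ h => (SimpleGraph.mem_neighborFinset _ _ _).2 h) v n 𝒮 h𝒮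

/-- ★ Geometric form: at most `32ⁿ` members (`C(2n, n) ≤ 4ⁿ`, Mathlib `Nat.centralBinom_le_four_pow`) — typed growth constant `λ_T = 32`, `p_ent,T = log 32`.
[folklore] -/
theorem card_siteAnimals_le_pow (v : Site 4) (n : ℕ) (𝒮 : Finset (Finset (Site 4)))
    (h𝒮 : ∀ S ∈ 𝒮, v ∈ S ∧ S.card = n + 1 ∧
      ∀ w ∈ S, Relation.ReflTransGen (fun x y => (zdGraph 4).Adj x y ∧ x ∈ S ∧ y ∈ S) v w) :
    𝒮.card ≤ 32 ^ n := by
  refine (card_siteAnimals_le_choose v n 𝒮 h𝒮).trans ?_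
  have h : (2 * n).choose n ≤ 4 ^ n := by
    rw [← Nat.centralBinom_eq_two_mul_choose]; exact Nat.centralBinom_le_four_pow _
  calc (2 * n).choose n * 8 ^ n ≤ 4 ^ n * 8 ^ n := Nat.mul_le_mul_right _ h
    _ = 32 ^ n := by rw [← mul_pow]; norm_num

/-- The tree's lazy-walk count for comparison (sets of cardinality AT MOST `n+1`): at most `81ⁿ` members (`LatticeAnimals.card_connectedFamily_le`, `Δ = 8`).
[cite: FriedliVelenik2017, Lemma 3.38 and eq. (5.27)] -/
theorem card_siteAnimals_le_lazy (v : Site 4) (n : ℕ) (𝒮 : Finset (Finset (Site 4)))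
    (h𝒮 : ∀ S ∈ 𝒮, v ∈ S ∧ S.card ≤ n + 1 ∧
      ∀ w ∈ S, Relation.ReflTransGen (fun x y => (zdGraph 4).Adj x y ∧ x ∈ S ∧ y ∈ S) v w) :
    𝒮.card ≤ 81 ^ n := by
  have h := card_connectedFamily_le (R := (zdGraph 4).Adj) (nbr := fun x => (zdGraph 4).neighborFinset x)
    (fun _ _ h => h.symm) card_neighborFinset_le_eight (fun _ _ h => (SimpleGraph.mem_neighborFinset _ _ _).2 h) v n 𝒮 h𝒮
  calc 𝒮.card ≤ (8 + 1) ^ (2 * n) := h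
    _ = 81 ^ n := by rw [pow_mul]; norm_num

end Summit.QuantumFields.YangMills.Theorems.Instrument.SiteAnimalBoundZ4

end
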